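import Literature.NumberTheory.Rogawski1990.ArchEPAssemblyBallIdentity   -- ★ (BI) p852321 (this seat): `ballIdentity_of_slices` (per-ball identity modulo `hIT`)
import Literature.NumberTheory.Rogawski1990.ArchEPAssemblyTransport      -- ★ (T1) p852310 (LH7-p01 (g8)): `blockReading_coupling_eq_average` (the `hIT` transport from the coupling)
import Literature.NumberTheory.Automorphic.ArchInnerTwistPlaceTransportOrb  -- ★ (IT)-2 p852102 (LH7-p04 (g8)): `isHaarMeasure_map_innerTwist_restrict` (the torus Haar image under `ι|_T`)
import HarnessLib

/-!
# EP ASSEMBLY — THE PER-BALL IDENTITY FROM THE COUPLING («(BI)-dock»): ★ (BI) `ballIdentity_of_slices` with its one binder `hIT` DISCHARGED by ★ (T1) from the coupling's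
# guarded ball identity; the torus Haar families, the Borel quotient σ-algebras and the block transport are HIDDEN inside (N8-INNER ROAD B, brick (12′) E3a (L2); Rogawski 1990 §14.2)

Topic `NumberTheory/Rogawski1990`; namespace `Literature.NumberTheory.Rogawski1990`.  THEOREMS ONLY (no `def`, no instance, no notation, no axiom, no named fact, no `sorry`).  Cell
`pub/hodgecm-mathlib`, crux H413 (`stmt-HodgeConjecture-24833`), F0∕P3c road «N8-INNER» ROAD B, brick (12′) «EP ASSEMBLY», layer (L2) «the glue»: the binder `hBI` of (G1) «glue-PC»
`ArchEPAssemblyBallTransfer` (LH7-p04 (g9), skeleton v1 2026-09-02 18:02:37Z :99–:137) AS A THEOREM, TOKEN FOR TOKEN (★ p852328's `hBI`; plus one instance-implicit `[Fintype ↥D]`, which the consumer's elaboration fills).  Seat LH3-p03 (g8).  Count-neutral.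

THE MATHEMATICS.  Frames `α` (definite places = the Finset `D`, `hD : w ∈ D ↔ w ∉ splitChartPlaces L α`) and `β` (every place split), one-place Haar families `ν′_w` (frame `α`) and `νβ_w`
(frame `β`), place isomorphisms `ι_{w′} : U(α)_{w′} ≃ U(β)_{w′}` OFF `D` carrying chart blocks to chart blocks (`hι`) with `νβ_{w′} = (ι_{w′})⁎ ν′_{w′}` (`hνβ`).  GIVEN the data of one
ball — centres `y_v`, radii `εg_v`, E1 generators `(f_v, h_v)` (SPLIT∕COMPACT clauses, `h_v ≠ 0` on the ball), partition factors `F_v` living in the generator ball (`F_v z ≠ 0 → dist z y_v < εg_v`), a coupling `G`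
and the per-ball tensor `f(k) = (Π_v (2F_v∕h_v)(cl_v k) · f_v(k_v)) · G(cl_D k, k_{Dᶜ})` (`ArchSmooth`) — and GIVEN the coupling's GUARDED ball identity (`hG`: at a compact label `S`
(`D ∩ S = ∅`), a `G`-regular `c` with every `F_v(cl_v c) ≠ 0`, `G(cl_D c, ι_I y) = ∫_{Π_D U(α)} a′(e_α⁻¹((g_v γ^α_v(S, c_v) g_v⁻¹)_D, y)) d⊗ν′`), THEN for every pair of global Haar measures
EQUAL to the product-convention pair and every label `S`, `c ∈ RegG S`:
  `SS_β(f) S c = 3^{-#D} · SS_α((Π_v F_v ∘ cl_v) · a′) S c`.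
PROOF.  ★ (BI) ED. 2 `ballIdentity_of_slices_of_measurable` at `p := (· ∈ D)` with: the weights `mcl_v := 2F_v∕h_v` (MEASURABLE from `ContDiff F_v`, `ContDiff h_v` — not continuous in
general at the sphere of the generator ball, whence ★ hβ ED. 2 ∕ (BI) ED. 2),
`f ∈ C_c` from `ArchSmooth` (★ `ArchSmooth.continuous`∕`.hasCompactSupport`), torus Haar families CHOSEN here — `tα := chartHaarGLoc α` (★ `isHaarMeasure∕isInvInvariant_chartHaarGLoc`)
and `tβ :=` on `D` `chartHaarGLoc β`, off `D` the image `(ι|_T)⁎ chartHaarGLoc α` (★ `isHaarMeasure_map_innerTwist_restrict`) —, Borel quotient σ-algebras, and the binder `hIT`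
discharged per `(S, c, ρ₂)` by ★ (T1) `blockReading_coupling_eq_average` at the junction substitutions `z := cl_D c`, `cIβ := (c_{w′} ∘ ρ₂ w′)`, `cIα := ((1 ⊔ ρ₂)·c)|_{Dᶜ}`,
`cD := ((1 ⊔ ρ₂)·c)|_D` (J1: `= c|_D` since the glued relabelling is the identity on `D`; J3: `cIβ = cIα` since it is `ρ₂` off `D` — Mathlib `Equiv.piEquivPiSubtypeProd_symm_apply`), its
coupling hypothesis being `hG` (the product `Π_v F_v(cl_v c) ≠ 0` of (BI)'s guard gives every factor `≠ 0`).  Two-frame hygiene (LH7-p01 (g8)): the `β`-frame per-place measure facts are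
INSTANCE families (the E1 clause tokens `chartOrbGLoc L β …(νβw v)…` of (G1)'s letter need them), the `α`-frame family `ν′_w` is the `And`-package `hαm`; inside, the `β` package for ★
(T1) is assembled BEFORE the `α` facts enter by `haveI`.  Index currency: (G1)'s `↥D` with its `Fintype` instance as a BINDER `[Fintype ↥D]` (the consumer's elaboration picks the `Finset` instance; ★ (BI)∕(T1) at `p := (· ∈ D)`
carry `Subtype.fintype (· ∈ D)`; `Fintype _` is a subsingleton, so the proof SUBSTITUTES the binder by `Subtype.fintype` first — the device of ★ E2b's bridge — and keeps it as the local instance).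
HONEST LABEL: HC_CM is proved only modulo the 7 printed citations (2 remaining: hLiu418 = `stmt-HodgeConjecture-24832`, h413 = `stmt-HodgeConjecture-24833`) until rung 0 closes; count-neutral —
docking of ★ files, pays nothing alone.

## References
* [Rogawski1990] J. D. Rogawski, *Automorphic Representations of Unitary Groups in Three Variables*, Ann. of Math. Stud. 123 (1990), §4.1 (4.1.1) p. 39, §8.2 p. 122, §14.2 (14.2.1) pp. 232–233.
* [Shelstad1979] D. Shelstad, *Characters and inner forms of a quasi-split group over ℝ*, Compositio Math. 39 (1979), §4 pp. 22–24, Lemma 4.2 p. 23.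
* [Bouaziz1994IntegralesOrbitales] A. Bouaziz, *Intégrales orbitales sur les groupes de Lie réductifs*, Ann. Sci. ÉNS (4) 27 (1994), §6.2 p. 591.
* [Folland1995] G. B. Folland, *A Course in Abstract Harmonic Analysis* (1995), §2.6 Thm. 2.49, (2.52).
-/

set_option autoImplicit false

noncomputable section

open MeasureTheory MeasureTheory.Measure NumberField NumberField.InfinitePlace Matrix Complex Topology
open Literature.MeasureTheory.Group Literature.NumberTheory.Rogawski1990 Literature.NumberTheory.Automorphic Literature.NumberTheory.Automorphic.UnitaryGroup
  Literature.NumberTheory.Automorphic.ArchCartan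
open scoped MatrixGroups Matrix Classical ContDiff

namespace Literature.NumberTheory.Rogawski1990

section BallIdentityCoupling

variable (L : Type) [Field L] [NumberField L] [IsCMField L] (α β : Fin 3 → L) (D : Finset {w : InfinitePlace L // IsComplex w})
  [∀ w : {w : InfinitePlace L // IsComplex w}, MeasurableSpace ↥(archLocal L 3 (Matrix.diagonal α) w)]
  [∀ w : {w : InfinitePlace L // IsComplex w}, BorelSpace ↥(archLocal L 3 (Matrix.diagonal α) w)]
  [∀ w : {w : InfinitePlace L // IsComplex w}, LocallyCompactSpace ↥(archLocal L 3 (Matrix.diagonal α) w)]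
  [∀ w : {w : InfinitePlace L // IsComplex w}, SecondCountableTopology ↥(archLocal L 3 (Matrix.diagonal α) w)]
  [∀ w : {w : InfinitePlace L // IsComplex w}, MeasurableSpace ↥(archLocal L 3 (Matrix.diagonal β) w)]
  [∀ w : {w : InfinitePlace L // IsComplex w}, BorelSpace ↥(archLocal L 3 (Matrix.diagonal β) w)]
  [∀ w : {w : InfinitePlace L // IsComplex w}, LocallyCompactSpace ↥(archLocal L 3 (Matrix.diagonal β) w)]
  [∀ w : {w : InfinitePlace L // IsComplex w}, SecondCountableTopology ↥(archLocal L 3 (Matrix.diagonal β) w)]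
  [MeasurableSpace ↥(arch (↥(maximalRealSubfield L)) L (IsCMField.complexConj L) 3 (Matrix.diagonal α))] [BorelSpace ↥(arch (↥(maximalRealSubfield L)) L (IsCMField.complexConj L) 3 (Matrix.diagonal α))]
  [MeasurableSpace ↥(arch (↥(maximalRealSubfield L)) L (IsCMField.complexConj L) 3 (Matrix.diagonal β))] [BorelSpace ↥(arch (↥(maximalRealSubfield L)) L (IsCMField.complexConj L) 3 (Matrix.diagonal β))]
  -- the index `↥D`: ANY `Fintype` instance (binder — (G1)'s letter elaborates the `Finset` one, ★ (BI)∕(T1) at `p := (· ∈ D)` carry `Subtype.fintype`; a subsingleton, substituted inside)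
  [Fintype ↥D]
  -- two-frame hygiene: the `α`-frame family's Haar facts as an `And`-package, the `β`-frame family's as instances ((G1)'s E1 clause tokens `chartOrbGLoc L β …(νβw v)…` need them)
  (ν'w : ∀ w : {w : InfinitePlace L // IsComplex w}, Measure ↥(archLocal L 3 (Matrix.diagonal α) w))
  (hαm : ∀ w : {w : InfinitePlace L // IsComplex w}, (ν'w w).IsHaarMeasure ∧ (ν'w w).IsMulRightInvariant)
  (νβw : ∀ w : {w : InfinitePlace L // IsComplex w}, Measure ↥(archLocal L 3 (Matrix.diagonal β) w)) [∀ w, (νβw w).IsHaarMeasure] [∀ w, (νβw w).IsMulRightInvariant]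
  -- the place isomorphisms off `D` and the image measures ((G1)'s skeleton :73–:77 verbatim)
  (ι : ∀ w' : {w : {w : InfinitePlace L // IsComplex w} // w ∉ D}, ↥(archLocal L 3 (Matrix.diagonal α) w'.1) ≃ₜ* ↥(archLocal L 3 (Matrix.diagonal β) w'.1))
  (hι : ∀ (w' : {w : {w : InfinitePlace L // IsComplex w} // w ∉ D}) (S' : Finset {w : InfinitePlace L // IsComplex w}) (cw : Fin 3 → ℝ),
    ι w' (gprimeBlockAt L α w'.1 S' cw) = gprimeBlockAt L β w'.1 S' cw)
  (hνβ : ∀ w' : {w : {w : InfinitePlace L // IsComplex w} // w ∉ D}, νβw w'.1 = (ν'w w'.1).map (ι w'))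

include hαm hι hνβ in
/-- **THE PER-BALL IDENTITY FROM THE COUPLING** — ★ (G1) p852328 «glue-PC»'s binder `hBI` AS A THEOREM, token for token.  For one ball:
centres `y`, radii `εg`, generators `fv` with their `hv`, partition factors `F`, coupling `G`, the per-ball tensor `f` (`ArchSmooth`, shape `hf` with the weights `2F∕h` inline),
`Measurable (fv v)`, `ContDiff (hv v)`, `ContDiff (F v)`, `h_v ≠ 0` on the ball, the E1 SPLIT and COMPACT clauses of `fv v` at `(y v, εg v)`, `F v z ≠ 0 → dist z (y v) < εg v`, and
the coupling's GUARDED ball identity `hG` at the compact labels (★ (T1)'s `hG` letter at `z := cl`, `c_D := c|_D`); conclusion at any global pair EQUAL to the product-convention pair: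
`SS_β(f) S c = 3⁻¹ ^ Fintype.card ↥D * SS_α((∏_v F_v ∘ cl_v) · a′) S c` on every `RegG S`.  Proof: ★ (BI) ED. 2 `ballIdentity_of_slices_of_measurable` + ★ (T1) `blockReading_coupling_eq_average` (docblock).
[cite: Rogawski1990, §14.2 (14.2.1) pp. 232–233; §4.1 (4.1.1) p. 39] [cite: Shelstad1979, §4 p. 24; Lemma 4.2 p. 23] [cite: Bouaziz1994IntegralesOrbitales, §6.2 p. 591] [cite: Folland1995, §2.6 (2.52)] -/
theorem ballIdentity_of_coupling
    (hD : ∀ w, w ∈ D ↔ w ∉ splitChartPlaces L α) (hα : ∀ i, α i ≠ 0) (hβ0 : ∀ i, β i ≠ 0)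
    (hherm : ∀ i, (IsCMField.complexConj L (α i) : L) = α i) (hβsplit : ∀ w, w ∈ splitChartPlaces L β)
    (a' : ↥(arch (↥(maximalRealSubfield L)) L (IsCMField.complexConj L) 3 (Matrix.diagonal α)) → ℂ) (ha' : ArchSmooth L 3 (Matrix.diagonal α) a')
    (y : ↥D → ℂ × ℂ × ℂ) (εg : ↥D → ℝ)
    (fv : ∀ v : ↥D, ↥(archLocal L 3 (Matrix.diagonal β) (v : {w : InfinitePlace L // IsComplex w})) → ℂ) (hv : ↥D → ℂ × ℂ × ℂ → ℂ)
    (F : ↥D → ℂ × ℂ × ℂ → ℝ)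
    (G : (↥D → ℂ × ℂ × ℂ) → (∀ w' : {w : {w : InfinitePlace L // IsComplex w} // w ∉ D}, ↥(archLocal L 3 (Matrix.diagonal β) w'.1)) → ℂ)
    (f : ↥(arch (↥(maximalRealSubfield L)) L (IsCMField.complexConj L) 3 (Matrix.diagonal β)) → ℂ)
    -- the per-ball test function and its shape
    (hfs : ArchSmooth L 3 (Matrix.diagonal β) f)
    (hf : ∀ k, f k = (∏ v : ↥D, (2 * (F v (bzClassG L β k v) : ℂ) * (hv v (bzClassG L β k v))⁻¹) * fv v (archPiEquivCM 3 L (Matrix.diagonal β) k v)) *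
      G (fun v => bzClassG L β k v) (fun w' => archPiEquivCM 3 L (Matrix.diagonal β) k w'.1))
    (hfv : ∀ v, Measurable (fv v)) (hhv : ∀ v, ContDiff ℝ ∞ (hv v)) (hFc : ∀ v, ContDiff ℝ ∞ (F v))
    -- the generator clauses at the centre `y v` with radius `εg v`
    (hh0 : ∀ v z, dist z (y v) < εg v → hv v z ≠ 0)
    (hsplit : ∀ (v : ↥D) (S' : Finset {w : InfinitePlace L // IsComplex w}) (c : {w : InfinitePlace L // IsComplex w} → Fin 3 → ℝ),
      (v : {w : InfinitePlace L // IsComplex w}) ∈ S' → c v 0 ≠ 0 → dist (bzClassMapG S' c v) (y v) < εg v →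
        chartOrbGLoc L β (v : {w : InfinitePlace L // IsComplex w}) S' (νβw v) (fv v) (c v) = 0)
    (hcpt : ∀ (v : ↥D) (S' : Finset {w : InfinitePlace L // IsComplex w}) (c : {w : InfinitePlace L // IsComplex w} → Fin 3 → ℝ),
      (v : {w : InfinitePlace L // IsComplex w}) ∉ S' → (Function.Injective fun i : Fin 3 => Circle.exp (c v i)) → dist (bzClassMapG S' c v) (y v) < εg v →
        ∑ σ : Equiv.Perm (Fin 3), chartOrbGLoc L β (v : {w : InfinitePlace L // IsComplex w}) S' (νβw v) (fv v) (c v ∘ σ) = hv v (bzClassMapG S' c v))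
    -- the factor lives in the generator ball
    (hFε : ∀ v z, F v z ≠ 0 → dist z (y v) < εg v)
    -- the coupling's guarded transport identity at the compact labels (★ (T1)'s `hG` letter at `z := cl`, `c_D := c|_D`)
    (hG : ∀ (S : Finset {w : InfinitePlace L // IsComplex w}) (c : {w : InfinitePlace L // IsComplex w} → Fin 3 → ℝ), c ∈ RegG S →
      (∀ v : ↥D, (v : {w : InfinitePlace L // IsComplex w}) ∉ S) → (∀ v : ↥D, F v (bzClassMapG S c v) ≠ 0) →
      ∀ yI : (∀ w' : {w : {w : InfinitePlace L // IsComplex w} // w ∉ D}, ↥(archLocal L 3 (Matrix.diagonal α) w'.1)),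
        G (fun v => bzClassMapG S c v) (fun w' => ι w' (yI w')) =
          ∫ g : (∀ v : ↥D, ↥(archLocal L 3 (Matrix.diagonal α) (v : {w : InfinitePlace L // IsComplex w}))),
            a' ((archPiEquivCM 3 L (Matrix.diagonal α)).symm
              ((MeasurableEquiv.piEquivPiSubtypeProd (fun w : {w : InfinitePlace L // IsComplex w} => ↥(archLocal L 3 (Matrix.diagonal α) w)) (· ∈ D)).symm
                (fun v => g v * gprimeBlockAt L α v.1 S (c v) * (g v)⁻¹, yI)))
            ∂(Measure.pi fun v : ↥D => ν'w v)) :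
    -- conclusion, at any pair of global measures EQUAL to the product-convention pair
    ∀ (ν' : Measure ↥(arch (↥(maximalRealSubfield L)) L (IsCMField.complexConj L) 3 (Matrix.diagonal α))) [ν'.IsHaarMeasure] [ν'.IsMulRightInvariant],
      ν' = (Measure.pi ν'w).map (archPiEquivCM 3 L (Matrix.diagonal α)).symm →
    ∀ (νβ : Measure ↥(arch (↥(maximalRealSubfield L)) L (IsCMField.complexConj L) 3 (Matrix.diagonal β))) [νβ.IsHaarMeasure] [νβ.IsMulRightInvariant],
      νβ = (Measure.pi νβw).map (archPiEquivCM 3 L (Matrix.diagonal β)).symm →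
    ∀ (S : Finset {w : InfinitePlace L // IsComplex w}) (c : {w : InfinitePlace L // IsComplex w} → Fin 3 → ℝ), c ∈ RegG S →
      stableSumG (orbFamGExt L β νβ f) S c =
        ((3 : ℂ)⁻¹) ^ Fintype.card ↥D * stableSumG (orbFamGExt L α ν' (fun k => ((∏ v, F v (bzClassG L α k v) : ℝ) : ℂ) * a' k)) S c := by
  intro ν' _ _ hν νβ _ _ hνβg S₀ c₀ hc₀
  -- ONE `Fintype` instance on the index: substitute the binder by `Subtype.fintype` (★ (BI)∕(T1)'s at `p := (· ∈ D)`)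
  obtain rfl : ‹Fintype ↥D› = Subtype.fintype (fun x => x ∈ D) := Subsingleton.elim _ _
  -- … and keep it as THE local instance (the substitution removed the binder from the instance context; a fresh synthesis would find the `Finset` one)
  letI : Fintype ↥D := Subtype.fintype (fun x => x ∈ D)
  -- Borel quotient σ-algebras, per label, both frames (the ★ slices' abstract σ-algebra binders)
  letI : ∀ (S : Finset {w : InfinitePlace L // IsComplex w}) (w : {w : InfinitePlace L // IsComplex w}),
      MeasurableSpace (↥(archLocal L 3 (Matrix.diagonal β) w) ⧸ chartTorusGLoc L β w S) := fun S w => borel _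
  haveI : ∀ (S : Finset {w : InfinitePlace L // IsComplex w}) (w : {w : InfinitePlace L // IsComplex w}),
      BorelSpace (↥(archLocal L 3 (Matrix.diagonal β) w) ⧸ chartTorusGLoc L β w S) := fun S w => ⟨rfl⟩
  letI : ∀ (S : Finset {w : InfinitePlace L // IsComplex w}) (w : {w : InfinitePlace L // IsComplex w}),
      MeasurableSpace (↥(archLocal L 3 (Matrix.diagonal α) w) ⧸ chartTorusGLoc L α w S) := fun S w => borel _
  haveI : ∀ (S : Finset {w : InfinitePlace L // IsComplex w}) (w : {w : InfinitePlace L // IsComplex w}),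
      BorelSpace (↥(archLocal L 3 (Matrix.diagonal α) w) ⧸ chartTorusGLoc L α w S) := fun S w => ⟨rfl⟩
  -- the `β`-frame torus Haar family, per label: `chartHaarGLoc β` ON `D`, the `ι|_T`-image of `chartHaarGLoc α` OFF `D` (so that ★ (T1)'s `ht′` holds by `dif_neg`)
  set TB : ∀ (S : Finset {w : InfinitePlace L // IsComplex w}) (w : {w : InfinitePlace L // IsComplex w}), Measure ↥(chartTorusGLoc L β w S) :=
    fun S w => if h : w ∈ D then chartHaarGLoc L β w S else
      (chartHaarGLoc L α w S).map (ContinuousMulEquiv.restrictSubgroup (ι ⟨w, h⟩) (chartTorusGLoc L α w S) (chartTorusGLoc L β w S)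
        (fun g => (innerTwist_mem_chartTorusGLoc_iff L α β w (ι ⟨w, h⟩) (hι ⟨w, h⟩) S g).symm)) with hTB
  have hTBm : ∀ (S : Finset {w : InfinitePlace L // IsComplex w}) (w : {w : InfinitePlace L // IsComplex w}),
      (TB S w).IsHaarMeasure ∧ (TB S w).IsInvInvariant := by
    intro S w
    by_cases h : w ∈ D
    · simp only [hTB, dif_pos h]
      exact ⟨isHaarMeasure_chartHaarGLoc L β w S, isInvInvariant_chartHaarGLoc L β w S⟩
    · simp only [hTB, dif_neg h]
      haveI := isHaarMeasure_chartHaarGLoc L α w S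
      haveI := isInvInvariant_chartHaarGLoc L α w S
      exact isHaarMeasure_map_innerTwist_restrict L α β w (ι ⟨w, h⟩) S (hι ⟨w, h⟩) (chartHaarGLoc L α w S)
  haveI : ∀ (S : Finset {w : InfinitePlace L // IsComplex w}) (w : {w : InfinitePlace L // IsComplex w}), (TB S w).IsHaarMeasure := fun S w => (hTBm S w).1
  haveI : ∀ (S : Finset {w : InfinitePlace L // IsComplex w}) (w : {w : InfinitePlace L // IsComplex w}), (TB S w).IsInvInvariant := fun S w => (hTBm S w).2
  -- the inline weight `2F∕h` is MEASURABLE (no support condition needed; it need not be continuous at the sphere of the generator ball)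
  have hmclm : ∀ v : ↥D, Measurable fun z => 2 * (F v z : ℂ) * (hv v z)⁻¹ := fun v =>
    (measurable_const.mul (Complex.measurable_ofReal.comp (hFc v).continuous.measurable)).mul (hhv v).continuous.measurable.inv
  -- ★ (BI) ED. 2 (measurable weights) at `p := (· ∈ D)`, `tβ := TB`, `tα := chartHaarGLoc α`; its `hIT` binder is discharged below by ★ (T1)
  have hBI := ballIdentity_of_slices_of_measurable L α β νβw νβ hνβg TB ν'w hαm ν' hν (fun S w => chartHaarGLoc L α w S)
    (fun S w => ⟨isHaarMeasure_chartHaarGLoc L α w S, isInvInvariant_chartHaarGLoc L α w S⟩) (· ∈ D) hα hherm hβ0 hβsplit hD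
    ha'.continuous ha'.hasCompactSupport hfs.continuous hfs.hasCompactSupport (fun v z => 2 * (F v z : ℂ) * (hv v z)⁻¹) hmclm fv hfv G
    hf y εg F hv (fun v z => by rw [div_eq_mul_inv]) hFε hh0 hsplit hcpt ?_ S₀ c₀ hc₀
  · exact hBI
  -- the `hIT` binder from the coupling: ★ (T1) at the junction substitutions
  intro S c hc hS hr ρ₂ hρ₂
  have hF' : ∀ v : ↥D, F v (bzClassMapG S c v) ≠ 0 := fun v h0 =>
    hr (Finset.prod_eq_zero (Finset.mem_univ v) (by rw [h0, Complex.ofReal_zero]))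
  have hJ1 : ∀ w : ↥D, slotPerm ((Equiv.piEquivPiSubtypeProd (· ∈ D) (fun _ : {w : InfinitePlace L // IsComplex w} => Equiv.Perm (Fin 3))).symm (1, ρ₂)) c w.1 = c w.1 :=
    fun w => slotPerm_apply_of_eq_one (by rw [Equiv.piEquivPiSubtypeProd_symm_apply, dif_pos w.2]; rfl) c
  have hcI : (fun (w' : {w : {w : InfinitePlace L // IsComplex w} // w ∉ D}) (i : Fin 3) => c w'.1 (ρ₂ w' i)) =
      fun w' => slotPerm ((Equiv.piEquivPiSubtypeProd (· ∈ D) (fun _ : {w : InfinitePlace L // IsComplex w} => Equiv.Perm (Fin 3))).symm (1, ρ₂)) c w'.1 := by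
    funext w' i
    rw [slotPerm_apply, Equiv.piEquivPiSubtypeProd_symm_apply, dif_neg w'.2]
  -- the `β` package for ★ (T1), from the instances in scope (BEFORE the `α` facts enter)
  have hβm : ∀ w' : {w : {w : InfinitePlace L // IsComplex w} // w ∉ D},
      (TB S w'.1).IsHaarMeasure ∧ (TB S w'.1).IsInvInvariant ∧ (νβw w'.1).IsHaarMeasure ∧ (νβw w'.1).IsMulRightInvariant :=
    fun w' => ⟨inferInstance, inferInstance, inferInstance, inferInstance⟩
  have ht' : ∀ w' : {w : {w : InfinitePlace L // IsComplex w} // w ∉ D}, TB S w'.1 = (chartHaarGLoc L α w'.1 S).map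
      (ContinuousMulEquiv.restrictSubgroup (ι w') (chartTorusGLoc L α w'.1 S) (chartTorusGLoc L β w'.1 S)
        (fun g => (innerTwist_mem_chartTorusGLoc_iff L α β w'.1 (ι w') (hι w') S g).symm)) := fun w' => by
    simp only [hTB, dif_neg w'.2]
  -- the `α` facts enter (instances, for ★ (T1)'s `α`-side binders)
  haveI : ∀ w : {w : InfinitePlace L // IsComplex w}, (ν'w w).IsHaarMeasure := fun w => (hαm w).1
  haveI : ∀ w : {w : InfinitePlace L // IsComplex w}, (ν'w w).IsMulRightInvariant := fun w => (hαm w).2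
  haveI : ∀ w : {w : InfinitePlace L // IsComplex w}, (chartHaarGLoc L α w S).IsHaarMeasure := fun w => isHaarMeasure_chartHaarGLoc L α w S
  haveI : ∀ w : {w : InfinitePlace L // IsComplex w}, (chartHaarGLoc L α w S).IsInvInvariant := fun w => isInvInvariant_chartHaarGLoc L α w S
  -- ★ (BI)'s index subtypes carry `Subtype.fintype`; make ★ (T1)'s explicit `Fintype` binders the same
  letI : Fintype {w : {w : InfinitePlace L // IsComplex w} // (fun x => x ∈ D) w} := Subtype.fintype _
  letI : Fintype {w : {w : InfinitePlace L // IsComplex w} // ¬ (fun x => x ∈ D) w} := Subtype.fintype _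
  refine blockReading_coupling_eq_average L α β S νβw (fun w => TB S w) (· ∈ D) hβm ν'w (fun w => chartHaarGLoc L α w S) ι hι ht' hνβ
    (fun w => slotPerm ((Equiv.piEquivPiSubtypeProd (· ∈ D) (fun _ : {w : InfinitePlace L // IsComplex w} => Equiv.Perm (Fin 3))).symm (1, ρ₂)) c w.1)
    (fun w' i => c w'.1 (ρ₂ w' i))
    (fun w' => slotPerm ((Equiv.piEquivPiSubtypeProd (· ∈ D) (fun _ : {w : InfinitePlace L // IsComplex w} => Equiv.Perm (Fin 3))).symm (1, ρ₂)) c w'.1)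
    hcI a' G (fun w => bzClassMapG S c w.1) ?_
  -- the coupling hypothesis of ★ (T1) at `c_D := ((1 ⊔ ρ₂)·c)|_D = c|_D` (J1) is the guarded `hG`
  intro yI
  simp only [hJ1]
  exact hG S c hc (fun v => hS v.1 v.2) hF' yI

end BallIdentityCoupling

end Literature.NumberTheory.Rogawski1990

end
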